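import Summits.Ventures.YMGap.Thresholds.OneLinkEigenMoments
import Summits.Ventures.YMGap.Thresholds.OneLinkEigenIBP
import HarnessLib

/-!
# Venture YMGap — the one-link modulus, refined first order (2/3): the trace–trace covariance and the refined covariance lemma

HONEST FRAMING: venture file of the cell `pub-ymgap` (QuantumFields programme), strong-coupling LATTICE bookkeeping; nothing about
the continuum.  In the first-order identity `Cov(φ,u) = (1/λ)(E Γ(φ,u) + N·Cov(φ,γ))` of `OneLinkEigenModulus`,
`γ = −½Re tr(BgΔg) + const − (1/N)·X·Y` with `X = Im tr(Bg)`, `Y = Im tr(Δg)`; here the trace–trace product is decomposed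
as `Cov(φ, XY) = Cov(φ, X̃Ỹ) + EY·Cov(φ,X) + EX·Cov(φ,Y)` (`X̃ = X − EX`) and bounded by Schwinger–Dyson means and fourth moments
(`OneLinkEigenMoments`) instead of by its worst-case Lipschitz constant `2‖B‖_op‖Δ‖_F`:
* `abs_cov_trace_trace_le` — `|Cov_ν(φ, XY)| ≤ (√5·r/(N(1/2−r)√(1/2−r)) + (N²/(N²−1))·4r²/(1/2−r))·L·‖Δ‖_F`, `r = ‖B‖_op`;
* `cov_linear_le_refined` — `|Cov_ν(φ, N Re tr(·Δ))| ≤ K_ref(N,r)·L·‖Δ‖_F`,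
  `K_ref(N,r) = (N²/(N²−1))·(1 + r/(1/2−r) + (N²/(N²−1))·4r²/(1/2−r) + √5·r/(N(1/2−r)√(1/2−r)))` (the last term is `O(1/N)`).
The modulus and its rows: `OneLinkEigenRefinedRows`.  All `N ≥ 2`, hypothesis-free.
-/

noncomputable section

open scoped Matrix ComplexConjugate BigOperators ContDiff Matrix.Norms.Frobenius
open Matrix Complex Finset MeasureTheory ProbabilityTheory
open Literature.MathematicalPhysics.QuantumFieldTheory
open Literature.MathematicalPhysics.QuantumFieldTheory.SUNBakryEmery
open Literature.MathematicalPhysics.QuantumFieldTheory.Balaban1983to89.StrongCouplingDobrushinWindow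
open Literature.MathematicalPhysics.QuantumFieldTheory.Balaban1983to89.StrongCouplingKernelWindow

namespace Summit.Ventures.YMGap.OneLinkEigen

variable {N : ℕ}

section Tilted

/-- **The trace–trace covariance**: for `φ` bounded measurable `L`-Lipschitz and `X = Im tr(Bg)`, `Y = Im tr(Δg)`,
`|Cov_ν(φ, X·Y)| ≤ (√5·r/(N(1/2−r)√(1/2−r)) + (N²/(N²−1))·4r²/(1/2−r)) · L · ‖Δ‖_F`, `r = ‖B‖_op`
(decomposition `XY = X̃Ỹ + EY·X + EX·Y − EX·EY`, Schwinger–Dyson means, fourth moments). [folklore] -/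
theorem abs_cov_trace_trace_le (hN : 2 ≤ N) {B : Matrix (Fin N) (Fin N) ℂ} (hB : matrixOpNorm B < 1 / 2)
    (Δ : Matrix (Fin N) (Fin N) ℂ) (φ : SUN N → ℝ) {L : ℝ} (hφm : Measurable φ) (hφb : ∃ C, ∀ s, |φ s| ≤ C)
    (hL : 0 ≤ L) (hφL : ∀ a b, |φ a - φ b| ≤ L * suFrobDist a b) :
    |cov[φ, fun g : SUN N => (B * (g : Matrix (Fin N) (Fin N) ℂ)).trace.im * (Δ * (g : Matrix (Fin N) (Fin N) ℂ)).trace.im;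
        (haarProbability (SUN N)).tilted (fun g => (N : ℝ) * ((g : Matrix (Fin N) (Fin N) ℂ) * B).trace.re)]| ≤
      (Real.sqrt 5 * matrixOpNorm B / ((N : ℝ) * (1 / 2 - matrixOpNorm B) * Real.sqrt (1 / 2 - matrixOpNorm B))
        + (N : ℝ) ^ 2 / ((N : ℝ) ^ 2 - 1) * (4 * matrixOpNorm B ^ 2 / (1 / 2 - matrixOpNorm B))) * L * frobNorm Δ := by
  have hN0 : N ≠ 0 := by omega
  have hNpos : (0 : ℝ) < N := Nat.cast_pos.2 (Nat.pos_of_ne_zero hN0)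
  have hN2 : (2 : ℝ) ≤ N := by exact_mod_cast hN
  set r : ℝ := matrixOpNorm B with hrdef
  have hr0 : 0 ≤ r := matrixOpNorm_nonneg B
  have hrpos : 0 < 1 / 2 - r := by linarith
  have hΔ0 : 0 ≤ frobNorm Δ := frobNorm_nonneg Δ
  set lam : ℝ := (N : ℝ) - 1 / N with hlam
  have hlampos : 0 < lam := by
    have : (1 : ℝ) / N ≤ 1 / 2 := by rw [div_le_div_iff₀ hNpos (by norm_num)]; linarith
    rw [hlam]; linarith
  have hlam_eq : (N : ℝ) / lam = (N : ℝ) ^ 2 / ((N : ℝ) ^ 2 - 1) := by rw [hlam]; field_simp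
  set K : ℝ := (N : ℝ) * (1 / 2 - r) with hKdef
  have hKpos : 0 < K := mul_pos hNpos hrpos
  set ν : Measure (SUN N) :=
    (haarProbability (SUN N)).tilted (fun g => (N : ℝ) * ((g : Matrix (Fin N) (Fin N) ℂ) * B).trace.re) with hν
  have hexpc : Continuous fun g : SUN N => Real.exp (pot (N : ℝ) B g) :=
    Real.continuous_exp.comp (continuous_restrict (contDiff_pot _ B))
  have hexpi : Integrable (fun g : SUN N => Real.exp ((N : ℝ) * ((g : Matrix (Fin N) (Fin N) ℂ) * B).trace.re))
      (haarProbability (SUN N)) := integrable_of_continuous_SUN hexpc _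
  haveI : IsProbabilityMeasure ν := isProbabilityMeasure_tilted hexpi
  set X : SUN N → ℝ := fun g => (B * (g : Matrix (Fin N) (Fin N) ℂ)).trace.im with hX
  set Y : SUN N → ℝ := fun g => (Δ * (g : Matrix (Fin N) (Fin N) ℂ)).trace.im with hY
  set EX : ℝ := ∫ g, X g ∂ν with hEX
  set EY : ℝ := ∫ g, Y g ∂ν with hEY
  set P : SUN N → ℝ := fun g => (X g - EX) * (Y g - EY) with hP
  show |cov[φ, fun g => X g * Y g; ν]| ≤ _
  have hXeq : ∀ g : SUN N, X g = ((g : Matrix (Fin N) (Fin N) ℂ) * ((-I) • B)).trace.re := fun g => im_trace_mul_su_eq B g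
  have hYeq : ∀ g : SUN N, Y g = ((g : Matrix (Fin N) (Fin N) ℂ) * ((-I) • Δ)).trace.re := fun g => im_trace_mul_su_eq Δ g
  have hXc' : Continuous X := by
    have : X = fun g : SUN N => ((g : Matrix (Fin N) (Fin N) ℂ) * ((-I) • B)).trace.re := funext hXeq
    rw [this]; exact continuous_re_trace_su_mul _
  have hYc' : Continuous Y := by
    have : Y = fun g : SUN N => ((g : Matrix (Fin N) (Fin N) ℂ) * ((-I) • Δ)).trace.re := funext hYeq
    rw [this]; exact continuous_re_trace_su_mul _
  have hPc : Continuous P := (hXc'.sub continuous_const).mul (hYc'.sub continuous_const)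
  have mφ : MemLp φ 2 ν := by
    obtain ⟨C, hC⟩ := hφb
    exact MemLp.of_bound hφm.aestronglyMeasurable C (ae_of_all _ fun g => (Real.norm_eq_abs _).le.trans (hC g))
  have mX : MemLp X 2 ν := memLp_two_of_continuous hXc' ν
  have mY : MemLp Y 2 ν := memLp_two_of_continuous hYc' ν
  have mP : MemLp P 2 ν := memLp_two_of_continuous hPc ν
  have hcs : ∀ {F₁ F₂ : SUN N → ℝ}, MemLp F₁ 2 ν → MemLp F₂ 2 ν →
      |cov[F₁, F₂; ν]| ≤ Real.sqrt (Var[F₁; ν] * Var[F₂; ν]) := fun m1 m2 => by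
    rw [← Real.sqrt_sq_eq_abs]; exact Real.sqrt_le_sqrt (cov_sq_le_var_mul_var m1 m2)
  have hL2K : 0 ≤ L ^ 2 / K := div_nonneg (sq_nonneg L) hKpos.le
  have hvarφ : Var[φ; ν] ≤ L ^ 2 / K := haarPoincare_SU hN B hB φ L hL hφL
  -- generic: `|cov| ≤ √(Var φ · Var F) ≤ L a / K` when `Var F ≤ a²/K`
  have hcov_of_var : ∀ {F : SUN N → ℝ} {a : ℝ}, MemLp F 2 ν → 0 ≤ a → Var[F; ν] ≤ a ^ 2 / K →
      |cov[φ, F; ν]| ≤ L * a / K := fun {F} {a} mF ha hvF => by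
    refine (hcs mφ mF).trans ?_
    have hprod : Var[φ; ν] * Var[F; ν] ≤ (L * a / K) ^ 2 := by
      calc Var[φ; ν] * Var[F; ν] ≤ (L ^ 2 / K) * (a ^ 2 / K) := mul_le_mul hvarφ hvF (variance_nonneg _ _) hL2K
        _ = (L * a / K) ^ 2 := by rw [div_mul_div_comm, ← mul_pow, div_pow, pow_two K]
    calc Real.sqrt (Var[φ; ν] * Var[F; ν]) ≤ Real.sqrt ((L * a / K) ^ 2) := Real.sqrt_le_sqrt hprod
      _ = L * a / K := Real.sqrt_sq (by positivity)
  -- the decomposition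
  have hXY : (fun g => X g * Y g) = fun g => P g + (EY * X g + EX * Y g) + (-(EX * EY)) := by
    funext g; simp only [hP]; ring
  have hcovXY : cov[φ, fun g => X g * Y g; ν] = cov[φ, P; ν] + EY * cov[φ, X; ν] + EX * cov[φ, Y; ν] := by
    have iQ : Integrable (fun g => P g + (EY * X g + EX * Y g)) ν :=
      (mP.add ((mX.const_mul EY).add (mY.const_mul EX))).integrable one_le_two
    rw [hXY, covariance_add_const_right iQ]
    have e3 : (fun g => P g + (EY * X g + EX * Y g)) = P + ((fun g => EY * X g) + fun g => EX * Y g) := rfl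
    rw [e3, covariance_add_right mφ mP ((mX.const_mul EY).add (mY.const_mul EX)),
      covariance_add_right mφ (mX.const_mul EY) (mY.const_mul EX), covariance_const_mul_right,
      covariance_const_mul_right]
    ring
  -- Lipschitz constants, Poincaré and Schwinger–Dyson means for `X`, `Y`
  have hXL : ∀ x y : SUN N, |X x - X y| ≤ Real.sqrt N * r * suFrobDist x y := by
    intro x y
    rw [hXeq, hXeq]
    refine (abs_re_trace_su_mul_sub_le x y _).trans ?_
    rw [frobNorm_neg_I_smul, mul_comm]
    exact mul_le_mul_of_nonneg_right (frobNorm_le_sqrt_mul_matrixOpNorm B) (suFrobDist_nonneg _ _)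
  have hYL : ∀ x y : SUN N, |Y x - Y y| ≤ frobNorm Δ * suFrobDist x y := by
    intro x y
    rw [hYeq, hYeq]
    refine (abs_re_trace_su_mul_sub_le x y _).trans ?_
    rw [frobNorm_neg_I_smul, mul_comm]
  have hvarX : Var[X; ν] ≤ (Real.sqrt N * r) ^ 2 / K := haarPoincare_SU hN B hB X _ (by positivity) hXL
  have hvarY : Var[Y; ν] ≤ frobNorm Δ ^ 2 / K := haarPoincare_SU hN B hB Y _ hΔ0 hYL
  have hcovX : |cov[φ, X; ν]| ≤ L * (Real.sqrt N * r) / K := hcov_of_var mX (by positivity) hvarX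
  have hcovY : |cov[φ, Y; ν]| ≤ L * frobNorm Δ / K := hcov_of_var mY hΔ0 hvarY
  have hEXb : |EX| ≤ (N : ℝ) / lam * (2 * Real.sqrt N * r * (Real.sqrt N * r)) := by
    have h := abs_mean_linear_le hN B ((-I) • B)
    simp_rw [← hXeq] at h
    rw [frobNorm_neg_I_smul] at h
    refine h.trans (mul_le_mul_of_nonneg_left ?_ (div_pos hNpos hlampos).le)
    exact mul_le_mul_of_nonneg_left (frobNorm_le_sqrt_mul_matrixOpNorm B) (by positivity)
  have hEYb : |EY| ≤ (N : ℝ) / lam * (2 * Real.sqrt N * r * frobNorm Δ) := by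
    have h := abs_mean_linear_le hN B ((-I) • Δ)
    simp_rw [← hYeq] at h
    rwa [frobNorm_neg_I_smul] at h
  -- the centred product: fourth moments
  have hP2 : ∫ g, P g ^ 2 ∂ν ≤ 5 * ((Real.sqrt N * r) ^ 2 / K) * (frobNorm Δ ^ 2 / K) := by
    have e : (fun g => P g ^ 2) = fun g => (X g - EX) ^ 2 * (Y g - EY) ^ 2 := by funext g; simp only [hP]; ring
    rw [e]
    have h := trace_trace_sq_moment_le hN hB Δ
    rw [← hν] at h
    exact h
  have h5 : 0 ≤ 5 * ((Real.sqrt N * r) ^ 2 / K) * (frobNorm Δ ^ 2 / K) :=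
    mul_nonneg (mul_nonneg (by norm_num) (div_nonneg (sq_nonneg _) hKpos.le)) (div_nonneg (sq_nonneg _) hKpos.le)
  have hvarP : Var[P; ν] ≤ 5 * ((Real.sqrt N * r) ^ 2 / K) * (frobNorm Δ ^ 2 / K) := by
    rw [variance_eq_sub mP]
    have h0 : 0 ≤ (∫ g, P g ∂ν) ^ 2 := sq_nonneg _
    have e : (∫ g, (P ^ 2) g ∂ν) = ∫ g, P g ^ 2 ∂ν := rfl
    linarith [hP2]
  -- `|cov(φ,P)|² ≤ (L²/K) · 5 (N r²/K)(‖Δ‖²/K) = (√5 r L ‖Δ‖/(N (1/2−r) √(1/2−r)))²`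
  have hsqN : Real.sqrt N * Real.sqrt N = N := Real.mul_self_sqrt hNpos.le
  have hsqr : Real.sqrt (1 / 2 - r) * Real.sqrt (1 / 2 - r) = 1 / 2 - r := Real.mul_self_sqrt hrpos.le
  have hsq5 : Real.sqrt 5 * Real.sqrt 5 = 5 := Real.mul_self_sqrt (by norm_num)
  have hsqrpos : 0 < Real.sqrt (1 / 2 - r) := Real.sqrt_pos.2 hrpos
  set T : ℝ := Real.sqrt 5 * r * L * frobNorm Δ / ((N : ℝ) * (1 / 2 - r) * Real.sqrt (1 / 2 - r)) with hT
  have hT0 : 0 ≤ T := by rw [hT]; positivity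
  have hTsq : (L ^ 2 / K) * (5 * ((Real.sqrt N * r) ^ 2 / K) * (frobNorm Δ ^ 2 / K)) = T ^ 2 := by
    rw [hT, hKdef, div_pow, mul_pow, mul_pow, mul_pow, mul_pow, mul_pow]
    have e5 : Real.sqrt 5 ^ 2 = 5 := by rw [pow_two]; exact hsq5
    have eN : Real.sqrt N ^ 2 = N := by rw [pow_two]; exact hsqN
    have er : Real.sqrt (1 / 2 - r) ^ 2 = 1 / 2 - r := by rw [pow_two]; exact hsqr
    rw [e5, eN, er]
    field_simp
  have hcovP : |cov[φ, P; ν]| ≤ T := by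
    refine (hcs mφ mP).trans ?_
    have hprod : Var[φ; ν] * Var[P; ν] ≤ T ^ 2 := by
      calc Var[φ; ν] * Var[P; ν] ≤ (L ^ 2 / K) * (5 * ((Real.sqrt N * r) ^ 2 / K) * (frobNorm Δ ^ 2 / K)) :=
            mul_le_mul hvarφ hvarP (variance_nonneg _ _) hL2K
        _ = T ^ 2 := hTsq
    calc Real.sqrt (Var[φ; ν] * Var[P; ν]) ≤ Real.sqrt (T ^ 2) := Real.sqrt_le_sqrt hprod
      _ = T := Real.sqrt_sq hT0
  -- the two Schwinger–Dyson terms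
  have hC0 : 0 ≤ (N : ℝ) / lam := (div_pos hNpos hlampos).le
  have hterm_X : |EY * cov[φ, X; ν]| ≤ (N : ℝ) ^ 2 / ((N : ℝ) ^ 2 - 1) * (2 * r ^ 2 / (1 / 2 - r)) * L * frobNorm Δ := by
    rw [abs_mul]
    calc |EY| * |cov[φ, X; ν]| ≤ ((N : ℝ) / lam * (2 * Real.sqrt N * r * frobNorm Δ)) * (L * (Real.sqrt N * r) / K) :=
          mul_le_mul hEYb hcovX (abs_nonneg _) (mul_nonneg hC0 (by positivity))
      _ = (N : ℝ) / lam * (2 * r ^ 2 / (1 / 2 - r)) * L * frobNorm Δ * ((Real.sqrt N * Real.sqrt N) / N) := by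
          rw [hKdef]; field_simp
      _ = (N : ℝ) ^ 2 / ((N : ℝ) ^ 2 - 1) * (2 * r ^ 2 / (1 / 2 - r)) * L * frobNorm Δ := by
          rw [hsqN, div_self hNpos.ne', mul_one, hlam_eq]
  have hterm_Y : |EX * cov[φ, Y; ν]| ≤ (N : ℝ) ^ 2 / ((N : ℝ) ^ 2 - 1) * (2 * r ^ 2 / (1 / 2 - r)) * L * frobNorm Δ := by
    rw [abs_mul]
    calc |EX| * |cov[φ, Y; ν]| ≤ ((N : ℝ) / lam * (2 * Real.sqrt N * r * (Real.sqrt N * r))) * (L * frobNorm Δ / K) :=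
          mul_le_mul hEXb hcovY (abs_nonneg _) (mul_nonneg hC0 (by positivity))
      _ = (N : ℝ) / lam * (2 * r ^ 2 / (1 / 2 - r)) * L * frobNorm Δ * ((Real.sqrt N * Real.sqrt N) / N) := by
          rw [hKdef]; field_simp
      _ = (N : ℝ) ^ 2 / ((N : ℝ) ^ 2 - 1) * (2 * r ^ 2 / (1 / 2 - r)) * L * frobNorm Δ := by
          rw [hsqN, div_self hNpos.ne', mul_one, hlam_eq]
  rw [hcovXY]
  calc |cov[φ, P; ν] + EY * cov[φ, X; ν] + EX * cov[φ, Y; ν]|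
      ≤ |cov[φ, P; ν]| + |EY * cov[φ, X; ν]| + |EX * cov[φ, Y; ν]| :=
        (abs_add_le _ _).trans (add_le_add (abs_add_le _ _) le_rfl)
    _ ≤ T + (N : ℝ) ^ 2 / ((N : ℝ) ^ 2 - 1) * (2 * r ^ 2 / (1 / 2 - r)) * L * frobNorm Δ +
          (N : ℝ) ^ 2 / ((N : ℝ) ^ 2 - 1) * (2 * r ^ 2 / (1 / 2 - r)) * L * frobNorm Δ :=
        add_le_add (add_le_add hcovP hterm_X) hterm_Y
    _ = _ := by rw [hT]; ring

/-- **Refined covariance lemma** (first order of the eigenfunction expansion with the trace–trace term treated by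
Schwinger–Dyson means and fourth moments): for `N ≥ 2`, `‖B‖_op = r < 1/2`, `φ` bounded measurable `L`-Lipschitz, any `Δ`,
`|Cov_{ν_B}(φ, N Re tr(·Δ))| ≤ K_ref(N, r) · L · ‖Δ‖_F` with
`K_ref(N,r) = (N²/(N²−1))·(1 + r/(1/2−r) + (N²/(N²−1))·4r²/(1/2−r) + √5·r/(N(1/2−r)√(1/2−r)))`.
[cite: arXiv220412737, Lemma 4.1 and Rem. 1.3] -/
theorem cov_linear_le_refined (hN : 2 ≤ N) {B : Matrix (Fin N) (Fin N) ℂ} (hB : matrixOpNorm B < 1 / 2)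
    (Δ : Matrix (Fin N) (Fin N) ℂ) (φ : SUN N → ℝ) {L : ℝ} (hφm : Measurable φ) (hφb : ∃ C, ∀ s, |φ s| ≤ C)
    (hL : 0 ≤ L) (hφL : ∀ a b, |φ a - φ b| ≤ L * suFrobDist a b) :
    |∫ s, φ s * ((N : ℝ) * ((s : Matrix (Fin N) (Fin N) ℂ) * Δ).trace.re)
          ∂(haarProbability (SUN N)).tilted (fun g => (N : ℝ) * ((g : Matrix (Fin N) (Fin N) ℂ) * B).trace.re) -
        (∫ s, φ s ∂(haarProbability (SUN N)).tilted (fun g => (N : ℝ) * ((g : Matrix (Fin N) (Fin N) ℂ) * B).trace.re)) *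
          ∫ s, (N : ℝ) * ((s : Matrix (Fin N) (Fin N) ℂ) * Δ).trace.re
            ∂(haarProbability (SUN N)).tilted (fun g => (N : ℝ) * ((g : Matrix (Fin N) (Fin N) ℂ) * B).trace.re)| ≤
      (N : ℝ) ^ 2 / ((N : ℝ) ^ 2 - 1) *
          (1 + matrixOpNorm B / (1 / 2 - matrixOpNorm B)
            + (N : ℝ) ^ 2 / ((N : ℝ) ^ 2 - 1) * (4 * matrixOpNorm B ^ 2 / (1 / 2 - matrixOpNorm B))
            + Real.sqrt 5 * matrixOpNorm B / ((N : ℝ) * (1 / 2 - matrixOpNorm B) * Real.sqrt (1 / 2 - matrixOpNorm B))) *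
        L * frobNorm Δ := by
  have hN0 : N ≠ 0 := by omega
  have hNpos : (0 : ℝ) < N := Nat.cast_pos.2 (Nat.pos_of_ne_zero hN0)
  have hN2 : (2 : ℝ) ≤ N := by exact_mod_cast hN
  set r : ℝ := matrixOpNorm B with hrdef
  have hr0 : 0 ≤ r := matrixOpNorm_nonneg B
  have hrpos : 0 < 1 / 2 - r := by linarith
  have hΔ0 : 0 ≤ frobNorm Δ := frobNorm_nonneg Δ
  set lam : ℝ := (N : ℝ) - 1 / N with hlam
  have hlampos : 0 < lam := by
    have : (1 : ℝ) / N ≤ 1 / 2 := by rw [div_le_div_iff₀ hNpos (by norm_num)]; linarith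
    rw [hlam]; linarith
  have hlam_eq : (N : ℝ) / lam = (N : ℝ) ^ 2 / ((N : ℝ) ^ 2 - 1) := by rw [hlam]; field_simp
  set K : ℝ := (N : ℝ) * (1 / 2 - r) with hKdef
  have hKpos : 0 < K := mul_pos hNpos hrpos
  set S : Matrix (Fin N) (Fin N) ℂ → ℝ := pot (N : ℝ) B with hSdef
  set u : Matrix (Fin N) (Fin N) ℂ → ℝ := pot 1 Δ with hudef
  have hS : ContDiff ℝ ∞ S := contDiff_pot _ B
  have hu : ContDiff ℝ ∞ u := contDiff_pot _ Δ
  set ν : Measure (SUN N) :=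
    (haarProbability (SUN N)).tilted (fun g => (N : ℝ) * ((g : Matrix (Fin N) (Fin N) ℂ) * B).trace.re) with hν
  have hexpc : Continuous fun g : SUN N => Real.exp (S g) := Real.continuous_exp.comp (continuous_restrict hS)
  have hexpi : Integrable (fun g : SUN N => Real.exp ((N : ℝ) * ((g : Matrix (Fin N) (Fin N) ℂ) * B).trace.re))
      (haarProbability (SUN N)) := integrable_of_continuous_SUN hexpc _
  haveI : IsProbabilityMeasure ν := isProbabilityMeasure_tilted hexpi
  set Z : ℝ := ∫ g : SUN N, Real.exp (S g) ∂(haarSU N) with hZ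
  have hZpos : 0 < Z := integral_exp_pos (integrable_of_continuous_SUN hexpc _)
  have htilt : ∀ f : SUN N → ℝ, ∫ g, f g ∂ν = (∫ g : SUN N, Real.exp (S g) * f g ∂(haarSU N)) / Z := fun f => by
    rw [hν]; exact integral_tilted_eq_div _ f
  set w : SUN N → ℝ := fun s => (N : ℝ) * ((s : Matrix (Fin N) (Fin N) ℂ) * Δ).trace.re with hw
  set G : SUN N → ℝ := fun g => Gam S u g with hG
  set Lg : SUN N → ℝ := fun g => genL S u g with hLg
  set a : SUN N → ℝ := fun g => -(1 / 2) * (B * g * Δ * g).trace.re with ha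
  set XY : SUN N → ℝ := fun g => (B * (g : Matrix (Fin N) (Fin N) ℂ)).trace.im *
      (Δ * (g : Matrix (Fin N) (Fin N) ℂ)).trace.im with hXYdef
  have hGc : Continuous G := continuous_restrict (contDiff_Gam hS hu)
  have hLgc : Continuous Lg := continuous_restrict (contDiff_genL hS hu)
  have hwc : Continuous w := continuous_const.mul (continuous_re_trace_su_mul Δ)
  have hac : Continuous a := by
    refine continuous_const.mul (Complex.continuous_re.comp (Continuous.matrix_trace ?_))
    exact ((continuous_const.matrix_mul continuous_subtype_val).matrix_mul continuous_const).matrix_mul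
      continuous_subtype_val
  have hGγ : ∀ g : SUN N, G g = (N : ℝ) * a g + (-(XY g)) + (N : ℝ) * ((1 / 2) * (B * Δᴴ).trace.re) := by
    intro g
    simp only [hG, hSdef, hudef, Gam_pot_pot_su hN0, ha, hXYdef]
    field_simp
    ring
  have hXYc : Continuous XY := by
    have : XY = fun g => -(G g - (N : ℝ) * a g - (N : ℝ) * ((1 / 2) * (B * Δᴴ).trace.re)) := by
      funext g; rw [hGγ g]; ring
    rw [this]; exact ((hGc.sub (continuous_const.mul hac)).sub continuous_const).neg
  have hweq : w = fun g => ((N : ℝ) / lam) * (G g - Lg g) := by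
    funext g
    have h1 : w g = (N : ℝ) * pot 1 Δ g := by simp only [hw, pot, one_mul]
    rw [h1, pot_eq_Gam_sub_genL hN S 1 Δ]
    simp only [hG, hLg, hudef, hlam]
    field_simp
  have mφ : MemLp φ 2 ν := by
    obtain ⟨C, hC⟩ := hφb
    exact MemLp.of_bound hφm.aestronglyMeasurable C (ae_of_all _ fun g => (Real.norm_eq_abs _).le.trans (hC g))
  have mG : MemLp G 2 ν := memLp_two_of_continuous hGc ν
  have mLg : MemLp Lg 2 ν := memLp_two_of_continuous hLgc ν
  have mw : MemLp w 2 ν := memLp_two_of_continuous hwc ν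
  have ma : MemLp a 2 ν := memLp_two_of_continuous hac ν
  have mXY : MemLp XY 2 ν := memLp_two_of_continuous hXYc ν
  have hcovw : ∫ s, φ s * w s ∂ν - (∫ s, φ s ∂ν) * ∫ s, w s ∂ν = cov[φ, w; ν] := by
    rw [covariance_eq_sub mφ mw]; rfl
  have hsplit : cov[φ, w; ν] = ((N : ℝ) / lam) * (cov[φ, G; ν] - cov[φ, Lg; ν]) := by
    rw [hweq, show (fun g => (N : ℝ) / lam * (G g - Lg g)) = ((N : ℝ) / lam) • (G - Lg) by funext g; rfl,
      covariance_smul_right, covariance_sub_right mφ mG mLg]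
  -- (1) the integration-by-parts term, verbatim from `cov_linear_le`
  have hLg0 : ∫ g, Lg g ∂ν = 0 := by
    rw [htilt, integral_exp_mul_genL_eq_zero hN0 hS hu, zero_div]
  have hcovLg : cov[φ, Lg; ν] = ∫ g, φ g * Lg g ∂ν := by
    rw [covariance_eq_sub mφ mLg, hLg0, mul_zero, sub_zero]; rfl
  have hIBP : |cov[φ, Lg; ν]| ≤ L * frobNorm Δ := by
    rw [hcovLg]
    have h := abs_integral_mul_genL_le hN B Δ φ hφm hφb hL hφL
    rw [← hν] at h
    exact h
  -- (2) `cov[φ, G] = N cov[φ, a] − cov[φ, XY]`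
  have hcovG : cov[φ, G; ν] = (N : ℝ) * cov[φ, a; ν] - cov[φ, XY; ν] := by
    have e : G = fun g => ((N : ℝ) * a g + (-(XY g))) + (N : ℝ) * ((1 / 2) * (B * Δᴴ).trace.re) := funext hGγ
    have iY : Integrable (fun g => (N : ℝ) * a g + -(XY g)) ν := ((ma.const_mul (N : ℝ)).add mXY.neg).integrable one_le_two
    rw [e, covariance_add_const_right iY]
    have e2 : (fun g => (N : ℝ) * a g + -(XY g)) = (fun g => (N : ℝ) * a g) + -XY := rfl
    rw [e2, covariance_add_right mφ (ma.const_mul _) mXY.neg, covariance_neg_right, covariance_const_mul_right]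
    ring
  -- (2a) the quadratic word `a`
  have haL : ∀ x y : SUN N, |a x - a y| ≤ r * frobNorm Δ * suFrobDist x y := by
    intro x y
    simp only [ha]
    have h := abs_re_trace_word_sub_le B Δ x y
    rw [← mul_sub, abs_mul, abs_neg, abs_of_pos (by norm_num : (0 : ℝ) < 1 / 2)]
    nlinarith [h]
  have hvarφ : Var[φ; ν] ≤ L ^ 2 / K := haarPoincare_SU hN B hB φ L hL hφL
  have hvara : Var[a; ν] ≤ (r * frobNorm Δ) ^ 2 / K := haarPoincare_SU hN B hB a _ (by positivity) haL
  have hL2K : 0 ≤ L ^ 2 / K := div_nonneg (sq_nonneg L) hKpos.le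
  have hcova : |cov[φ, a; ν]| ≤ L * (r * frobNorm Δ) / K := by
    have hcs : |cov[φ, a; ν]| ≤ Real.sqrt (Var[φ; ν] * Var[a; ν]) := by
      rw [← Real.sqrt_sq_eq_abs]; exact Real.sqrt_le_sqrt (cov_sq_le_var_mul_var mφ ma)
    refine hcs.trans ?_
    have hprod : Var[φ; ν] * Var[a; ν] ≤ (L * (r * frobNorm Δ) / K) ^ 2 := by
      calc Var[φ; ν] * Var[a; ν] ≤ (L ^ 2 / K) * ((r * frobNorm Δ) ^ 2 / K) :=
            mul_le_mul hvarφ hvara (variance_nonneg _ _) hL2K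
        _ = (L * (r * frobNorm Δ) / K) ^ 2 := by rw [div_mul_div_comm, ← mul_pow, div_pow, pow_two K]
    calc Real.sqrt (Var[φ; ν] * Var[a; ν]) ≤ Real.sqrt ((L * (r * frobNorm Δ) / K) ^ 2) := Real.sqrt_le_sqrt hprod
      _ = L * (r * frobNorm Δ) / K := Real.sqrt_sq (by positivity)
  -- (2b) the trace–trace term
  have hXYle := abs_cov_trace_trace_le hN hB Δ φ hφm hφb hL hφL
  rw [← hν, ← hrdef] at hXYle
  have hXYle' : |cov[φ, XY; ν]| ≤ (Real.sqrt 5 * r / ((N : ℝ) * (1 / 2 - r) * Real.sqrt (1 / 2 - r))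
        + (N : ℝ) ^ 2 / ((N : ℝ) ^ 2 - 1) * (4 * r ^ 2 / (1 / 2 - r))) * L * frobNorm Δ := hXYle
  -- (3) assemble
  have hN21 : (0 : ℝ) < (N : ℝ) ^ 2 - 1 := by nlinarith
  have hC0 : 0 ≤ (N : ℝ) ^ 2 / ((N : ℝ) ^ 2 - 1) := by positivity
  have hterm_a : (N : ℝ) * |cov[φ, a; ν]| ≤ r / (1 / 2 - r) * L * frobNorm Δ := by
    calc (N : ℝ) * |cov[φ, a; ν]| ≤ (N : ℝ) * (L * (r * frobNorm Δ) / K) := mul_le_mul_of_nonneg_left hcova hNpos.le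
      _ = r / (1 / 2 - r) * L * frobNorm Δ := by rw [hKdef]; field_simp
  have hcovG_le : |cov[φ, G; ν]| ≤ r / (1 / 2 - r) * L * frobNorm Δ +
      (Real.sqrt 5 * r / ((N : ℝ) * (1 / 2 - r) * Real.sqrt (1 / 2 - r))
        + (N : ℝ) ^ 2 / ((N : ℝ) ^ 2 - 1) * (4 * r ^ 2 / (1 / 2 - r))) * L * frobNorm Δ := by
    rw [hcovG]
    refine (abs_sub _ _).trans (add_le_add ?_ hXYle')
    rw [abs_mul, abs_of_pos hNpos]; exact hterm_a
  rw [hcovw, hsplit, abs_mul, abs_of_pos (div_pos hNpos hlampos), hlam_eq]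
  have hfin := (abs_sub (cov[φ, G; ν]) (cov[φ, Lg; ν])).trans (add_le_add hcovG_le hIBP)
  refine (mul_le_mul_of_nonneg_left hfin hC0).trans (le_of_eq ?_)
  ring

end Tilted

end Summit.Ventures.YMGap.OneLinkEigen
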